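import Literature.NumberTheory.QuadraticFields.QuadraticDedekindZetaOddPrimitive
import Literature.NumberTheory.QuadraticFields.ImaginaryResiduePiForm
import Mathlib.NumberTheory.NumberField.ClassNumber
import HarnessLib

/-!
# The trivial effective lower bound `L(1,χ) ≥ π/√q` for an odd real primitive character

For the odd primitive quadratic Dirichlet character `χ` mod `q > 4` and the imaginary quadratic
field `K` of discriminant `−q` one has `ζ_K = ζ · L(χ)`
(`Quadratic.dedekindZeta_eq_riemannZeta_mul_LFunction_of_odd_primitive`), hence the class number
formula `L(1,χ) = 2π h_K/(w_K √q)` (`Quadratic.LFunction_one_eq_of_discr_neg_of_eq`) with `w_K = 2`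
(`q > 4`, `Quadratic.torsionOrder_eq_two_of_discr_lt_neg_four`) and `h_K ≥ 1`, so
`|L(1,χ)| = π h_K/√q ≥ π/√q`. This is the bound Conrey–Iwaniec (2002) record as (1.5)
(`L(1,χ) = πh/√q`) and which §9 of that paper needs only to absorb the remainder `(q/X)^{1/2}` of
Corollary 6.3 (6.49).

PROVED HERE (theorems only, no definitions, no named facts):
* `ConreyIwaniec2002.norm_LFunction_one_ge` — the bound for a GIVEN quadratic field `K` with
  `[K:ℚ] = 2`, `d_K = −q` (verbatim the stub S6 `stub_norm_LFunction_one_ge` of the `ls-inputs`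
  skeleton I6b, line `prop81-moebius-perron`);
* `ConreyIwaniec2002.pi_div_sqrt_le_norm_LFunction_one` — the same without `K` in the signature
  (the field exists: `Quadratic.exists_quadraticField_of_odd_primitive`).

Template: `Watkins2004.sqrt_mul_norm_LFunction_one_ge` (`ClassNumbersUpToOneHundred.lean`), which is
the same computation with `h_K ≥ 101` in place of `h_K ≥ 1`. Nothing about zeros of `L`-functions is
asserted here.

## References

* [ConreyIwaniec2002] B. Conrey, H. Iwaniec, Acta Arith. 103 (2002) 259–312, arXiv:math/0111012:
  §1 (1.5); §6 Corollary 6.3 (6.49).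
* [NeukirchANT1999] J. Neukirch, *Algebraic Number Theory*, Ch. VII §5 (5.11) (class number formula).
-/

noncomputable section

namespace Literature.NumberTheory.LFunctions

namespace ConreyIwaniec2002

open Literature.NumberTheory.QuadraticFields

/-- **The trivial effective lower bound `π/√q ≤ |L(1,χ)|`** for the odd primitive quadratic
character `χ` mod `q > 4`, given the imaginary quadratic field `K` with `[K:ℚ] = 2` and
`d_K = −q`: by `ζ_K = ζ·L(χ)` and the class number formula `L(1,χ) = 2πh_K/(w_K√q)` with
`w_K = 2` (as `−q < −4`) and `h_K ≥ 1`. [cite: ConreyIwaniec2002, §1 (1.5); §6 (6.49)]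
[cite: NeukirchANT1999, Ch. VII §5 (5.11)] -/
theorem norm_LFunction_one_ge (q : ℕ) [NeZero q] (hq : 4 < q)
    (χ : DirichletCharacter ℂ q) (hprim : χ.IsPrimitive) (hquad : χ.IsQuadratic) (hodd : χ.Odd)
    (K : Type) [Field K] [NumberField K] (h2 : Module.finrank ℚ K = 2)
    (hdisc : NumberField.discr K = -(q : ℤ)) :
    Real.pi / Real.sqrt q ≤ ‖χ.LFunction 1‖ := by
  classical
  have hq0 : 0 < q := by omega
  have hd : NumberField.discr K < 0 := by rw [hdisc, neg_lt_zero]; exact_mod_cast hq0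
  have hd4 : NumberField.discr K < -4 := by rw [hdisc]; omega
  -- `χ ≠ 1` (it is odd)
  have hχ1 : χ ≠ 1 := by
    intro h1
    have hm : χ (-1) = -1 := hodd
    rw [h1, MulChar.one_apply isUnit_one.neg] at hm
    norm_num at hm
  -- `ζ_K = ζ · L(χ)` for real `s > 1`, in `LSeries` form
  have hζ : ∀ s : ℝ, 1 < s →
      NumberField.dedekindZeta K s = riemannZeta s * LSeries (fun n => χ n) s := by
    intro s hs
    have hs' : 1 < (s : ℂ).re := by simpa using hs
    rw [← DirichletCharacter.LFunction_eq_LSeries χ hs']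
    exact Quadratic.dedekindZeta_eq_riemannZeta_mul_LFunction_of_odd_primitive hprim hquad hodd h2
      hdisc hs'
  -- class number formula with `w = 2`
  have hL := Quadratic.LFunction_one_eq_of_discr_neg_of_eq h2 hd hχ1 hζ
  have habs : |(NumberField.discr K : ℝ)| = (q : ℝ) := by
    rw [hdisc]; push_cast; rw [abs_neg]; exact abs_of_nonneg (Nat.cast_nonneg q)
  have hw : (NumberField.Units.torsionOrder K : ℝ) = 2 := by
    exact_mod_cast Quadratic.torsionOrder_eq_two_of_discr_lt_neg_four h2 hd4
  rw [habs, hw] at hL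
  -- `h_K ≥ 1`
  have h1 : (1 : ℝ) ≤ NumberField.classNumber K :=
    Nat.one_le_cast.mpr (NumberField.classNumber_pos (K := K))
  have hsqrt : 0 < Real.sqrt q := Real.sqrt_pos.mpr (by exact_mod_cast hq0)
  have hval : ‖χ.LFunction 1‖ = Real.pi * NumberField.classNumber K / Real.sqrt q := by
    rw [hL, Complex.norm_real, Real.norm_eq_abs, abs_of_nonneg (by positivity)]
    field_simp
  rw [hval]
  exact div_le_div_of_nonneg_right (by nlinarith [Real.pi_pos]) hsqrt.le

/-- **`π/√q ≤ |L(1,χ)|` for every odd primitive quadratic character `χ` mod `q > 4`** (the field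
`K = ℚ(√−q)` of the previous statement exists, `Quadratic.exists_quadraticField_of_odd_primitive`).
[cite: ConreyIwaniec2002, §1 (1.5)] [cite: NeukirchANT1999, Ch. VII §5 (5.11)] -/
theorem pi_div_sqrt_le_norm_LFunction_one {q : ℕ} [NeZero q] (hq : 4 < q)
    {χ : DirichletCharacter ℂ q} (hprim : χ.IsPrimitive) (hquad : χ.IsQuadratic) (hodd : χ.Odd) :
    Real.pi / Real.sqrt q ≤ ‖χ.LFunction 1‖ := by
  obtain ⟨K, instF, instNF, h2, hdK⟩ :=
    Quadratic.exists_quadraticField_of_odd_primitive hprim hquad hodd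
  exact norm_LFunction_one_ge q hq χ hprim hquad hodd K h2 hdK

end ConreyIwaniec2002

end Literature.NumberTheory.LFunctions

end
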